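import Mathlib
import Summits.NavierStokesRegularity.FluidComputer.TransportGalerkinEigenFourier
import Summits.NavierStokesRegularity.FluidComputer.TransportGalerkinAbc
import Summits.NavierStokesRegularity.FluidComputer.TransportGalerkinBox
import Literature.Analysis.FluidPDE.SteadyNSLatticePersistence
import HarnessLib

/-!
# Galerkin limit of the transport model, XIV: the field preserves the three linear clauses (instab g19, cell `ns-blowup`, 2026-08-27)

HONEST FRAMING (human ruling D-0035): nothing here is a claim about Navier–Stokes blow-up.
WHAT THIS IS NOT: not NS — algebra of Fourier coefficients on `ℤ³` (Leray symbol, conjugate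
symmetry, transversality); no flow, box radii or certificate is constructed.

PURPOSE. After parts IV–XIII the KEEP word for the model (`TransportGalerkinEmergenceLevels`,
`TransportGalerkinAbcH2.exists_keep_eigenvector_abc_of_levels`) takes the Galerkin levels only as
`C¹` solutions of the finite-dimensional ODE `y' = P_N F(y)` KEEPING THE THREE LINEAR CLAUSES of
`TransportGalerkin.box` (Leray-fixed, real through `proj`, divergence-free through `proj`). This file
proves, for `V = ℂ³`, `π = proj`, `P = lerayCLM` and any rapidly decreasing REAL host `Uv`, that the
field maps constrained rapidly decreasing elements to constrained elements (`nsField_clauses`), and so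
does every truncated field `P_N ∘ F` (`cubeProj_nsField_clauses`): the clauses define an INVARIANT
closed subspace of each Galerkin level, so a solution of the ODE restricted to that subspace is a
solution keeping the clauses — the «linear invariants» input is discharged up to finite-dimensional
ODE existence.

Ingredients: `TransportGalerkinEigenFourier.coe_linOp_proj_lerayCLM_apply` (coefficients of `linOp` in
the scalar-Fourier vocabulary), the same computation for `bilOp` (§1), `SteadyLattice.nl_neg`
(conjugate symmetry of the transport symbol), `SteadyLattice.lerayCoeff_neg_conjVec`,
`SteadyLattice.kdot_lerayCoeff`, `SteadyLattice.lerayCoeff_of_kdot_eq_zero`.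
-/

noncomputable section

open scoped ENNReal NNReal ComplexConjugate InnerProductSpace

namespace Summit.NavierStokesRegularity.FluidComputer.TransportGalerkinInvariance

open Literature.Analysis.FunctionSpaces Literature.Analysis.FunctionSpaces.Lattice
open Literature.Analysis.FunctionSpaces.Torus Literature.Analysis.FunctionSpaces.EuclideanSpace
open Literature.Analysis.FluidPDE Literature.Analysis.FluidPDE.ScalarFourier
open Summit.NavierStokesRegularity.FluidComputer.TransportGalerkin
open Summit.NavierStokesRegularity.FluidComputer.TransportGalerkinRapid
open Summit.NavierStokesRegularity.FluidComputer.TransportGalerkinBox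
open Summit.NavierStokesRegularity.FluidComputer.TransportGalerkinEigenFourier
open Summit.NavierStokesRegularity.FluidComputer.TransportGalerkinAbc

/-! ## §1 Coefficients of `bilOp` in the scalar-Fourier vocabulary -/

section Coeff

/-- `bilCoeff proj u v (k) = −N(u, v)(k)` with `N(a,b)(k)_p = transportSym (a··) (b·_p) k`. -/
theorem bilCoeff_proj_apply {u v : (Fin 3 → ℤ) → EuclideanSpace ℂ (Fin 3)} (hu : RapidDecay u)
    (hv : RapidDecay v) (k : Fin 3 → ℤ) :
    bilCoeff (fun j => (EuclideanSpace.proj j : EuclideanSpace ℂ (Fin 3) →L[ℂ] ℂ)) u v k =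
      -(WithLp.toLp 2 (fun p : Fin 3 => transportSym (fun j m => u m j) (fun m => v m p) k) :
        EuclideanSpace ℂ (Fin 3)) := by
  rw [bilCoeff_eq, Pi.neg_apply]
  congr 1
  ext p
  rw [PiLp.toLp_apply]
  exact apply_sum_conv_scal_freqDeriv (y := fun j m => u m j) (fun j => exists_bound_proj_comp hu j)
    (summable_norm_freqDeriv hv) k p

/-- **The coefficients of `bilOp proj lerayCLM x y` on rapidly decreasing elements**:
`(bilOp x y)(k) = −Λ²(k) • Π_k N(û, v̂)(k)` with `û = Λ⁻² ⇑x`, `v̂ = Λ⁻² ⇑y`. -/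
theorem coe_bilOp_proj_lerayCLM_apply {x y : lp (fun _ : (Fin 3 → ℤ) => EuclideanSpace ℂ (Fin 3)) 2} (hx : RapidDecay (⇑x)) (hy : RapidDecay (⇑y))
    (k : Fin 3 → ℤ) :
    (bilOp (fun j => (EuclideanSpace.proj j : EuclideanSpace ℂ (Fin 3) →L[ℂ] ℂ)) lerayCLM x y :
        (Fin 3 → ℤ) → EuclideanSpace ℂ (Fin 3)) k =
      -((sobolevWeight 2 k : ℂ) • lerayCLM k
        (WithLp.toLp 2 (fun p : Fin 3 => transportSym (fun j m => wmul (-2) (⇑x) m j)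
          (fun m => wmul (-2) (⇑y) m p) k) : EuclideanSpace ℂ (Fin 3))) := by
  have h1 := coe_bilOp_of_rapidDecay (π := fun j => (EuclideanSpace.proj j : EuclideanSpace ℂ (Fin 3) →L[ℂ] ℂ))
    (P := lerayCLM) norm_lerayCLM_le hx hy
  have h2 := bilCoeff_proj_apply (rapidDecay_wmul hx (-2)) (rapidDecay_wmul hy (-2)) k
  rw [h1, wmul_apply, h2, ContinuousLinearMap.map_neg, smul_neg]

end Coeff

/-! ## §2 The clauses, in the `IsConjSymm` / transversality vocabulary -/

section Clauses

/-- The reality clause of `box` through `proj` is conjugate symmetry of the family. -/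
theorem isConjSymm_iff_proj (c : (Fin 3 → ℤ) → EuclideanSpace ℂ (Fin 3)) :
    IsConjSymm c ↔ ∀ (j : Fin 3) (k : Fin 3 → ℤ),
      (EuclideanSpace.proj j : EuclideanSpace ℂ (Fin 3) →L[ℂ] ℂ) (c (-k)) =
        conj ((EuclideanSpace.proj j : EuclideanSpace ℂ (Fin 3) →L[ℂ] ℂ) (c k)) := by
  constructor
  · intro h j k
    rw [show (EuclideanSpace.proj j : EuclideanSpace ℂ (Fin 3) →L[ℂ] ℂ) (c (-k)) = c (-k) j from rfl, h k,
      conjVec_apply]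
    rfl
  · intro h k
    ext j
    rw [conjVec_apply]
    exact h j k

/-- Conjugate symmetry passes to `Λ^s`-rescalings (real even weights). -/
theorem isConjSymm_wmul {c : (Fin 3 → ℤ) → EuclideanSpace ℂ (Fin 3)} (hc : IsConjSymm c) (s : ℝ) :
    IsConjSymm (wmul s c) := by
  intro k
  rw [wmul_apply, wmul_apply, hc k, conjVec_smul, Complex.conj_ofReal, sobolevWeight, sobolevWeight,
    freqNormSq_neg]

/-- A real scalar multiple of a conjugate-symmetric vector at `−k`. -/
theorem conjVec_real_smul (r : ℝ) (w : EuclideanSpace ℂ (Fin 3)) :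
    conjVec ((r : ℂ) • w) = (r : ℂ) • conjVec w := by
  rw [conjVec_smul, Complex.conj_ofReal]

end Clauses

/-! ## §3 The field preserves the clauses -/

section Field

variable {ν : ℝ} {Uv : (Fin 3 → ℤ) → EuclideanSpace ℂ (Fin 3)}

/-- **Transversality of the field** (unconditional): `∑_j k_j (F x)(k)_j = 0` for every rapidly
decreasing `x` — the Leray symbol lands in `k^⊥` (`SteadyLattice.kdot_lerayCoeff`). -/
theorem nsField_div (hUv : RapidDecay Uv) {x : lp (fun _ : (Fin 3 → ℤ) => EuclideanSpace ℂ (Fin 3)) 2} (hx : RapidDecay (⇑x)) (k : Fin 3 → ℤ) :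
    ∑ j, ((k j : ℤ) : ℂ) * (EuclideanSpace.proj j : EuclideanSpace ℂ (Fin 3) →L[ℂ] ℂ)
      ((nsField ν Uv (fun j => (EuclideanSpace.proj j : EuclideanSpace ℂ (Fin 3) →L[ℂ] ℂ)) lerayCLM x :
        (Fin 3 → ℤ) → EuclideanSpace ℂ (Fin 3)) k) = 0 := by
  rw [nsField_eq, lp.coeFn_add, Pi.add_apply, coe_linOp_proj_lerayCLM_apply hUv hx k,
    coe_bilOp_proj_lerayCLM_apply hx hx k, lerayCLM_apply, lerayCLM_apply]
  set a := Torus.lerayCoeff k ((((ν * (4 * Real.pi ^ 2 * freqNormSq k)) : ℝ) : ℂ) • wmul (-2) (⇑x) k +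
    ((WithLp.toLp 2 (fun p : Fin 3 => transportSym (fun j m => Uv m j) (fun m => wmul (-2) (⇑x) m p) k) :
        EuclideanSpace ℂ (Fin 3)) +
      (WithLp.toLp 2 (fun p : Fin 3 => transportSym (fun j m => wmul (-2) (⇑x) m j) (fun m => Uv m p) k) :
        EuclideanSpace ℂ (Fin 3)))) with ha
  set b := Torus.lerayCoeff k (WithLp.toLp 2 (fun p : Fin 3 => transportSym (fun j m => wmul (-2) (⇑x) m j)
    (fun m => wmul (-2) (⇑x) m p) k) : EuclideanSpace ℂ (Fin 3)) with hb
  have hA : ∑ jj : Fin 3, ((k jj : ℤ) : ℂ) * a jj = 0 := SteadyLattice.kdot_lerayCoeff k _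
  have hB : ∑ jj : Fin 3, ((k jj : ℤ) : ℂ) * b jj = 0 := SteadyLattice.kdot_lerayCoeff k _
  have hterm : ∀ j : Fin 3, ((k j : ℤ) : ℂ) * (EuclideanSpace.proj j : EuclideanSpace ℂ (Fin 3) →L[ℂ] ℂ)
      (-((sobolevWeight 2 k : ℂ) • a) + -((sobolevWeight 2 k : ℂ) • b)) =
        -(sobolevWeight 2 k : ℂ) * (((k j : ℤ) : ℂ) * a j) + -(sobolevWeight 2 k : ℂ) * (((k j : ℤ) : ℂ) * b j) := by
    intro j
    rw [show (EuclideanSpace.proj j : EuclideanSpace ℂ (Fin 3) →L[ℂ] ℂ)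
      (-((sobolevWeight 2 k : ℂ) • a) + -((sobolevWeight 2 k : ℂ) • b)) =
        (-((sobolevWeight 2 k : ℂ) • a) + -((sobolevWeight 2 k : ℂ) • b)) j from rfl,
      PiLp.add_apply, PiLp.neg_apply, PiLp.neg_apply, PiLp.smul_apply, PiLp.smul_apply, smul_eq_mul, smul_eq_mul]
    ring
  rw [Finset.sum_congr rfl fun j _ => hterm j, Finset.sum_add_distrib, ← Finset.mul_sum, ← Finset.mul_sum,
    hA, hB, mul_zero, add_zero]

/-- **The field is Leray-fixed** (unconditional): `Π_k (F x)(k) = (F x)(k)`. -/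
theorem nsField_fix (hUv : RapidDecay Uv) {x : lp (fun _ : (Fin 3 → ℤ) => EuclideanSpace ℂ (Fin 3)) 2} (hx : RapidDecay (⇑x)) (k : Fin 3 → ℤ) :
    lerayCLM k ((nsField ν Uv (fun j => (EuclideanSpace.proj j : EuclideanSpace ℂ (Fin 3) →L[ℂ] ℂ)) lerayCLM x :
        (Fin 3 → ℤ) → EuclideanSpace ℂ (Fin 3)) k) =
      (nsField ν Uv (fun j => (EuclideanSpace.proj j : EuclideanSpace ℂ (Fin 3) →L[ℂ] ℂ)) lerayCLM x :
        (Fin 3 → ℤ) → EuclideanSpace ℂ (Fin 3)) k := by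
  by_cases hk : k = 0
  · subst hk
    rw [nsField_eq, lp.coeFn_add, Pi.add_apply, coe_linOp_proj_lerayCLM_apply hUv hx 0,
      coe_bilOp_proj_lerayCLM_apply hx hx 0, lerayCLM_zero]
    simp
  · rw [lerayCLM_apply]
    exact SteadyLattice.lerayCoeff_of_kdot_eq_zero hk (nsField_div hUv hx k)

/-- **The field preserves reality**: for a conjugate-symmetric host and a conjugate-symmetric rapidly
decreasing `x`, `F x` is conjugate symmetric (`SteadyLattice.nl_neg` for the two transport symbols
and the self-advection, `SteadyLattice.lerayCoeff_neg_conjVec` for the Leray symbol, even real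
weights for `Λ^{±2}` and the dissipation multiplier). -/
theorem nsField_real (hUv : RapidDecay Uv) (hUreal : IsConjSymm Uv) {x : lp (fun _ : (Fin 3 → ℤ) => EuclideanSpace ℂ (Fin 3)) 2} (hx : RapidDecay (⇑x))
    (hreal : IsConjSymm (⇑x)) :
    IsConjSymm (⇑(nsField ν Uv (fun j => (EuclideanSpace.proj j : EuclideanSpace ℂ (Fin 3) →L[ℂ] ℂ)) lerayCLM x)) := by
  have hû : IsConjSymm (wmul (-2) (⇑x)) := isConjSymm_wmul hreal (-2)
  intro k
  rw [nsField_eq, lp.coeFn_add, Pi.add_apply, Pi.add_apply,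
    coe_linOp_proj_lerayCLM_apply hUv hx (-k), coe_bilOp_proj_lerayCLM_apply hx hx (-k),
    coe_linOp_proj_lerayCLM_apply hUv hx k, coe_bilOp_proj_lerayCLM_apply hx hx k]
  rw [SteadyLattice.nl_neg _ _ hUreal hû, SteadyLattice.nl_neg _ _ hû hUreal, SteadyLattice.nl_neg _ _ hû hû,
    hû k, lerayCLM_apply, lerayCLM_apply, lerayCLM_apply, lerayCLM_apply]
  have hw2 : (sobolevWeight 2 (-k) : ℂ) = (sobolevWeight 2 k : ℂ) := by
    rw [sobolevWeight, sobolevWeight, freqNormSq_neg]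
  have hν : ((ν * (4 * Real.pi ^ 2 * freqNormSq (-k)) : ℝ) : ℂ) =
      ((ν * (4 * Real.pi ^ 2 * freqNormSq k) : ℝ) : ℂ) := by rw [freqNormSq_neg]
  rw [hw2, hν, ← conjVec_real_smul, ← conjVec_add, ← conjVec_add, SteadyLattice.lerayCoeff_neg_conjVec,
    SteadyLattice.lerayCoeff_neg_conjVec, ← conjVec_real_smul, ← conjVec_real_smul,
    ← conjVec_neg, ← conjVec_neg, ← conjVec_add]

/-- **The field maps constrained rapidly decreasing elements to constrained elements**
(`nsField_clauses`): the three linear clauses of `TransportGalerkin.box` (through `proj`, with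
`lerayCLM`) pass from `x` to `F x`, for any rapidly decreasing conjugate-symmetric host on `ℤ³`. -/
theorem nsField_clauses (hUv : RapidDecay Uv) (hUreal : IsConjSymm Uv) {x : lp (fun _ : (Fin 3 → ℤ) => EuclideanSpace ℂ (Fin 3)) 2} (hx : RapidDecay (⇑x))
    (hreal : ∀ (j : Fin 3) (k : Fin 3 → ℤ), (EuclideanSpace.proj j : EuclideanSpace ℂ (Fin 3) →L[ℂ] ℂ) (x (-k)) =
      conj ((EuclideanSpace.proj j : EuclideanSpace ℂ (Fin 3) →L[ℂ] ℂ) (x k))) :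
    (∀ k, lerayCLM k ((nsField ν Uv (fun j => (EuclideanSpace.proj j : EuclideanSpace ℂ (Fin 3) →L[ℂ] ℂ)) lerayCLM x :
        (Fin 3 → ℤ) → EuclideanSpace ℂ (Fin 3)) k) =
      (nsField ν Uv (fun j => (EuclideanSpace.proj j : EuclideanSpace ℂ (Fin 3) →L[ℂ] ℂ)) lerayCLM x :
        (Fin 3 → ℤ) → EuclideanSpace ℂ (Fin 3)) k) ∧
    (∀ (j : Fin 3) (k : Fin 3 → ℤ), (EuclideanSpace.proj j : EuclideanSpace ℂ (Fin 3) →L[ℂ] ℂ)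
      ((nsField ν Uv (fun j => (EuclideanSpace.proj j : EuclideanSpace ℂ (Fin 3) →L[ℂ] ℂ)) lerayCLM x :
        (Fin 3 → ℤ) → EuclideanSpace ℂ (Fin 3)) (-k)) =
      conj ((EuclideanSpace.proj j : EuclideanSpace ℂ (Fin 3) →L[ℂ] ℂ)
        ((nsField ν Uv (fun j => (EuclideanSpace.proj j : EuclideanSpace ℂ (Fin 3) →L[ℂ] ℂ)) lerayCLM x :
          (Fin 3 → ℤ) → EuclideanSpace ℂ (Fin 3)) k))) ∧
    (∀ k : Fin 3 → ℤ, ∑ j, ((k j : ℤ) : ℂ) * (EuclideanSpace.proj j : EuclideanSpace ℂ (Fin 3) →L[ℂ] ℂ)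
      ((nsField ν Uv (fun j => (EuclideanSpace.proj j : EuclideanSpace ℂ (Fin 3) →L[ℂ] ℂ)) lerayCLM x :
        (Fin 3 → ℤ) → EuclideanSpace ℂ (Fin 3)) k) = 0) :=
  ⟨nsField_fix hUv hx, (isConjSymm_iff_proj _).1 (nsField_real hUv hUreal hx ((isConjSymm_iff_proj _).2 hreal)),
    nsField_div hUv hx⟩

/-- **…and so does every truncated field `P_N ∘ F`** (`cubeProj_nsField_clauses`): the cube
truncations preserve the clauses (`TransportGalerkinBox.cubeProj_mem_box` with the radii
`ρ k = ‖(F x) k‖`). -/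
theorem cubeProj_nsField_clauses (hUv : RapidDecay Uv) (hUreal : IsConjSymm Uv) {x : lp (fun _ : (Fin 3 → ℤ) => EuclideanSpace ℂ (Fin 3)) 2} (hx : RapidDecay (⇑x))
    (hreal : ∀ (j : Fin 3) (k : Fin 3 → ℤ), (EuclideanSpace.proj j : EuclideanSpace ℂ (Fin 3) →L[ℂ] ℂ) (x (-k)) =
      conj ((EuclideanSpace.proj j : EuclideanSpace ℂ (Fin 3) →L[ℂ] ℂ) (x k))) (N : ℕ) :
    cubeProj N (nsField ν Uv (fun j => (EuclideanSpace.proj j : EuclideanSpace ℂ (Fin 3) →L[ℂ] ℂ)) lerayCLM x) ∈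
      box (fun k => ‖(nsField ν Uv (fun j => (EuclideanSpace.proj j : EuclideanSpace ℂ (Fin 3) →L[ℂ] ℂ)) lerayCLM x :
          (Fin 3 → ℤ) → EuclideanSpace ℂ (Fin 3)) k‖)
        (fun j => (EuclideanSpace.proj j : EuclideanSpace ℂ (Fin 3) →L[ℂ] ℂ)) lerayCLM := by
  obtain ⟨h1, h2, h3⟩ := nsField_clauses (ν := ν) hUv hUreal hx hreal
  exact cubeProj_mem_box (mem_box.2 ⟨fun k => le_rfl, h1, h2, h3⟩) N

/-- **ABC instance**: the forced-ABC field and all its cube truncations preserve the clauses. -/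
theorem cubeProj_nsField_abc_clauses (A B C : ℝ) {ν : ℝ} {x : lp (fun _ : (Fin 3 → ℤ) => EuclideanSpace ℂ (Fin 3)) 2} (hx : RapidDecay (⇑x))
    (hreal : ∀ (j : Fin 3) (k : Fin 3 → ℤ), (EuclideanSpace.proj j : EuclideanSpace ℂ (Fin 3) →L[ℂ] ℂ) (x (-k)) =
      conj ((EuclideanSpace.proj j : EuclideanSpace ℂ (Fin 3) →L[ℂ] ℂ) (x k))) (N : ℕ) :
    cubeProj N (nsField ν (UnitAddTorus.mFourierCoeff (EuclideanSpace.complexify ∘ Torus.abcFlow A B C))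
        (fun j => (EuclideanSpace.proj j : EuclideanSpace ℂ (Fin 3) →L[ℂ] ℂ)) lerayCLM x) ∈
      box (fun k => ‖(nsField ν (UnitAddTorus.mFourierCoeff (EuclideanSpace.complexify ∘ Torus.abcFlow A B C))
          (fun j => (EuclideanSpace.proj j : EuclideanSpace ℂ (Fin 3) →L[ℂ] ℂ)) lerayCLM x :
          (Fin 3 → ℤ) → EuclideanSpace ℂ (Fin 3)) k‖)
        (fun j => (EuclideanSpace.proj j : EuclideanSpace ℂ (Fin 3) →L[ℂ] ℂ)) lerayCLM :=
  cubeProj_nsField_clauses (rapidDecay_abcHost A B C) ((isConjSymm_iff_proj _).2 (abcHost_real A B C)) hx hreal N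

end Field

end Summit.NavierStokesRegularity.FluidComputer.TransportGalerkinInvariance

end
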